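import Literature.Geometry.Lorentzian.CauchyDevelopmentOneJet
import Literature.Geometry.Lorentzian.LorentzianMetricProofs
import Literature.Geometry.Lorentzian.LeviCivitaProofs
import Literature.Geometry.Lorentzian.CauchyPieceDomain
import Literature.Geometry.Lorentzian.CausalCurveEndpoint
import Literature.Geometry.Lorentzian.SpacelikePieceDomain
import HarnessLib

/-!
# The domain of dependence of an open piece of the Cauchy hypersurface of a Cauchy development

For a Cauchy development `𝒟 = (M, g, τ, ι, ν)` of initial data on the connected `n`-manifold `X`
(`CauchyDevelopment.lean`) and an open connected `O ⊆ X`: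

* `DataEmbedding.eventually_abs_val_normal_le` — the image `S = ι(X)` of a data embedding is
  tangent at `a = ι x` to `ν_x^⊥` in the first-order (slab) sense of `SpacelikePieceDomain.lean`:
  `|g_a(ν_x, φ σ - φ a)| ≤ κ ‖φ σ - φ a‖` for all `σ ∈ S` near `a`, every `κ > 0`
  (differentiability of `ι` read in charts, `ν ⊥ dι`, injectivity of `dι`, and `ι` a topological
  embedding);
* `DataEmbedding.eventually_mem_image_of_isOpen` — `ι(O)` is relatively open in `ι(X)`;
* `CauchyDevelopment.exists_isConnected_restrict_image` — **there is a connected open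
  sub-spacetime `V ⊆ M` containing `ι(O)` in which `ι(O)` is a Cauchy hypersurface**, namely the
  connected component containing `ι(O)` of
  `M ∖ closure (I⁺(S ∖ ι O) ∪ I⁻(S ∖ ι O) ∪ (S ∖ ι O))` (from which `V` is disjoint);
* `CauchyDevelopment.exists_isConnected_restrict_range_comp` — the same for `O = Φ(N)`, `Φ` an
  open embedding of a connected manifold: the displayed input `hc` of the sub-data development
  theorem of the Choquet-Bruhat–Geroch theory (route SwallowTheDatum of `FinalStateConjecture`,
  `SubdataDevelopmentsEmbed.hdod_of_cauchyRegion`);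
* `CauchyDevelopment.false_of_isFutureCausalCurveOn_range_embed` — the Cauchy hypersurface
  `ι(X)` of a Cauchy development is *acausal* (met at most once by every causal curve).

This is Hawking–Ellis 1973, Prop. 6.6.3 / 6.6.7 and O'Neill 1983, Ch. 14, Thm. 14.38 with
Lemma 14.43 ("the Cauchy development `D(A)` of an acausal hypersurface `A` is open and globally
hyperbolic with Cauchy hypersurface `A`") in the form needed for open pieces of the Cauchy
hypersurface of a development: assembled from the pure causality theorem
`IsCauchyHypersurface.exists_isConnected_restrict` (`CauchyPieceDomain.lean`), the endpoint
property of timelike curves `mem_chronologicalFuture_of_hasPastEndpoint`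
(`CausalCurveEndpoint.lean`, exponential map) and the local theorem for spacelike pieces
`IsCauchyHypersurface.disjoint_closure_of_spacelike` (`SpacelikePieceDomain.lean`).

Everything is proved; no definitions, no named facts (D-0026).

## References

* S. W. Hawking, G. F. R. Ellis, *The large scale structure of space-time*, CUP 1973, §6.5–6.6,
  Prop. 6.6.3, 6.6.7. [HawkingEllis1973CUP]
* B. O'Neill, *Semi-Riemannian geometry with applications to relativity*, Academic Press 1983,
  Ch. 14, Thm. 14.38, Lemma 14.43 (pp. 423–426). [ONeillSemiRiemannian1983]
* Y. Choquet-Bruhat, R. Geroch, Comm. Math. Phys. 14 (1969) 329–335, p. 333.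
  [ChoquetBruhatGeroch1969CMP]
* J. Sbierski, Ann. Henri Poincaré 17 (2016) = arXiv:1309.7591, §3.2, proof of Thm. 3.5.
  [Sbierski2016AHP]
-/

noncomputable section

open Bundle Set Filter Function Topology TopologicalSpace Asymptotics
open scoped Manifold ContDiff Topology

namespace Literature.Geometry.Lorentzian

universe u

variable {n : ℕ} {X : Type u} [TopologicalSpace X] [ChartedSpace (EuclideanSpace ℝ (Fin n)) X]
  [IsManifold (𝓡 n) ∞ X] [ConnectedSpace X] {D : InitialDataSet (𝓡 n) X}

namespace DataEmbedding

/-- **The image of a data embedding is tangent to the orthogonal complement of its normal**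
(the slab condition of `not_mem_closure_chronologicalFuture_sdiff`): for every `κ > 0` and all
points `σ = ι y` of `ι(X)` near `a = ι x`, `|g_a(ν_x, φ σ - φ a)| ≤ κ ‖φ σ - φ a‖` in the chart
`φ = extChartAt a`. Proof: read `ι` in the charts at `x` and `a`; its differential `L = dι_x` is
injective (`mfderiv_embed_injective`), so `‖h‖ ≤ C ‖L h‖`; `φ(ι y) - φ a = L h + o(h)` with
`g_a(ν, L h) = 0` (`ν ⊥ dι`), and `ι` is an embedding, so `σ → a` in `M` forces `y → x`.
O'Neill 1983, Ch. 4, p. 98 (normal fields) and Ch. 1 (immersed submanifolds, slice charts).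
[cite: ONeillSemiRiemannian1983, Ch. 4, p. 98] -/
theorem eventually_abs_val_normal_le (𝒮 : DataEmbedding D) (x : X) {κ : ℝ} (hκ : 0 < κ) :
    ∀ᶠ σ in 𝓝 (𝒮.embed x), σ ∈ range 𝒮.embed →
      |𝒮.metric.val (𝒮.embed x) (𝒮.normal x)
          (extChartAt (𝓡 (n + 1)) (𝒮.embed x) σ - extChartAt (𝓡 (n + 1)) (𝒮.embed x) (𝒮.embed x))| ≤
        κ * ‖extChartAt (𝓡 (n + 1)) (𝒮.embed x) σ -
          extChartAt (𝓡 (n + 1)) (𝒮.embed x) (𝒮.embed x)‖ := by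
  set ι := 𝒮.embed with hι
  set a : 𝒮.carrier := ι x with ha
  set φ := extChartAt (𝓡 (n + 1)) a with hφ
  set ψ := extChartAt (𝓡 n) x with hψ
  set y₀ : EuclideanSpace ℝ (Fin n) := ψ x with hy₀
  set ν := 𝒮.normal x with hν
  set L : EuclideanSpace ℝ (Fin n) →L[ℝ] EuclideanSpace ℝ (Fin (n + 1)) :=
    mfderiv (𝓡 n) (𝓡 (n + 1)) ι x with hL
  set gν : EuclideanSpace ℝ (Fin (n + 1)) →L[ℝ] ℝ := 𝒮.metric.val a ν with hgν
  -- differentiability of `ι` at `x`, read in charts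
  have hmd : MDifferentiableAt (𝓡 n) (𝓡 (n + 1)) ι x := 𝒮.mdifferentiable_embed x
  have hF : HasFDerivAt (writtenInExtChartAt (𝓡 n) (𝓡 (n + 1)) x ι) L y₀ := by
    have h := hmd.hasMFDerivAt.2
    rw [ModelWithCorners.Boundaryless.range_eq_univ, hasFDerivWithinAt_univ] at h
    exact h
  -- normality: `g_a(ν, L h) = 0`
  have hnormal : ∀ h : EuclideanSpace ℝ (Fin n), gν (L h) = 0 := fun h ↦
    𝒮.isFutureUnitNormal.1.1 x h
  -- injectivity of `L`: `‖h‖ ≤ C ‖L h‖`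
  obtain ⟨C, hC, hCL⟩ : ∃ C : ℝ, 0 < C ∧ ∀ h : EuclideanSpace ℝ (Fin n), ‖h‖ ≤ C * ‖L h‖ := by
    have hker : LinearMap.ker (L : EuclideanSpace ℝ (Fin n) →ₗ[ℝ] EuclideanSpace ℝ (Fin (n + 1))) =
        ⊥ := LinearMap.ker_eq_bot.2 (𝒮.mfderiv_embed_injective x)
    obtain ⟨K, hK, hKL⟩ := LinearMap.exists_antilipschitzWith _ hker
    refine ⟨K, by exact_mod_cast hK, fun h ↦ ?_⟩
    have := hKL.le_mul_dist h 0
    simp only [dist_zero_right, LinearMap.map_zero, ContinuousLinearMap.coe_coe] at this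
    exact this
  -- the little-o estimate with `ε`
  set ε : ℝ := min (1 / (2 * C)) (κ / (2 * C * (‖gν‖ + 1))) with hε
  have hεpos : 0 < ε := by positivity
  have hεC : C * ε ≤ 1 / 2 := by
    have h1 : ε ≤ 1 / (2 * C) := min_le_left _ _
    rw [le_div_iff₀ (by positivity)] at h1
    linarith
  have hεκ : ‖gν‖ * ε * (2 * C) ≤ κ := by
    have h1 : ε ≤ κ / (2 * C * (‖gν‖ + 1)) := min_le_right _ _
    rw [le_div_iff₀ (by positivity)] at h1
    nlinarith [norm_nonneg gν, hεpos, hC]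
  have hlo : ∀ᶠ y' in 𝓝 y₀, ‖writtenInExtChartAt (𝓡 n) (𝓡 (n + 1)) x ι y' -
      writtenInExtChartAt (𝓡 n) (𝓡 (n + 1)) x ι y₀ - L (y' - y₀)‖ ≤ ε * ‖y' - y₀‖ :=
    hF.isLittleO.bound hεpos
  -- transport to `𝓝 x` and add the chart-domain conditions
  have hev : ∀ᶠ y in 𝓝 x, y ∈ ψ.source ∧ ι y ∈ φ.source ∧
      ‖φ (ι y) - φ a - L (ψ y - y₀)‖ ≤ ε * ‖ψ y - y₀‖ := by
    have h1 : ∀ᶠ y in 𝓝 x, y ∈ ψ.source := extChartAt_source_mem_nhds x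
    have h2 : ∀ᶠ y in 𝓝 x, ι y ∈ φ.source :=
      hmd.continuousAt.preimage_mem_nhds (extChartAt_source_mem_nhds (I := 𝓡 (n + 1)) a)
    have h3 : ∀ᶠ y in 𝓝 x, ‖writtenInExtChartAt (𝓡 n) (𝓡 (n + 1)) x ι (ψ y) -
        writtenInExtChartAt (𝓡 n) (𝓡 (n + 1)) x ι y₀ - L (ψ y - y₀)‖ ≤ ε * ‖ψ y - y₀‖ :=
      (continuousAt_extChartAt (I := 𝓡 n) x).eventually hlo
    filter_upwards [h1, h2, h3] with y hy1 hy2 hy3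
    refine ⟨hy1, hy2, ?_⟩
    have e1 : writtenInExtChartAt (𝓡 n) (𝓡 (n + 1)) x ι (ψ y) = φ (ι y) := by
      show φ (ι (ψ.symm (ψ y))) = φ (ι y)
      rw [ψ.left_inv hy1]
    have e2 : writtenInExtChartAt (𝓡 n) (𝓡 (n + 1)) x ι y₀ = φ a := by
      show φ (ι (ψ.symm (ψ x))) = φ a
      rw [ψ.left_inv (mem_extChartAt_source x)]
    rw [e1, e2] at hy3
    exact hy3
  -- from `𝓝 x` to `𝓝 a` through the embedding
  have hemb : IsEmbedding ι := 𝒮.isSmoothEmbedding.isEmbedding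
  obtain ⟨W, hWsub, hWo, hxW⟩ := mem_nhds_iff.1 hev
  obtain ⟨U, hUo, hUW⟩ := hemb.isInducing.isOpen_iff.1 hWo
  have haU : a ∈ U := by
    have : x ∈ ι ⁻¹' U := by rw [hUW]; exact hxW
    exact this
  filter_upwards [hUo.mem_nhds haU] with σ hσU hσS
  obtain ⟨y, rfl⟩ := hσS
  have hyW : y ∈ W := by rw [← hUW]; exact hσU
  obtain ⟨hy1, hy2, hy3⟩ := hWsub hyW
  -- the estimate at `σ = ι y`
  set h : EuclideanSpace ℝ (Fin n) := ψ y - y₀ with hh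
  set r : EuclideanSpace ℝ (Fin (n + 1)) := φ (ι y) - φ a - L h with hr
  have hr_le : ‖r‖ ≤ ε * ‖h‖ := hy3
  have hdec : φ (ι y) - φ a = L h + r := by rw [hr]; abel
  have hval : gν (φ (ι y) - φ a) = gν r := by
    rw [hdec, map_add, hnormal h, zero_add]
  have hh_le : ‖h‖ ≤ 2 * C * ‖φ (ι y) - φ a‖ := by
    have h1 : ‖h‖ ≤ C * ‖L h‖ := hCL h
    have h2 : ‖L h‖ ≤ ‖φ (ι y) - φ a‖ + ‖r‖ := by
      have : L h = (φ (ι y) - φ a) - r := by rw [hdec]; abel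
      rw [this]; exact norm_sub_le _ _
    have h3 : ‖h‖ ≤ C * ‖φ (ι y) - φ a‖ + C * ε * ‖h‖ := by nlinarith [hr_le, hC.le]
    nlinarith [hεC, norm_nonneg h, norm_nonneg (φ (ι y) - φ a), hC.le]
  show |gν (φ (ι y) - φ a)| ≤ κ * ‖φ (ι y) - φ a‖
  rw [hval]
  calc |gν r| ≤ ‖gν‖ * ‖r‖ := by rw [← Real.norm_eq_abs]; exact gν.le_opNorm r
    _ ≤ ‖gν‖ * (ε * ‖h‖) := mul_le_mul_of_nonneg_left hr_le (norm_nonneg _)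
    _ ≤ ‖gν‖ * (ε * (2 * C * ‖φ (ι y) - φ a‖)) :=
        mul_le_mul_of_nonneg_left (mul_le_mul_of_nonneg_left hh_le hεpos.le) (norm_nonneg _)
    _ = (‖gν‖ * ε * (2 * C)) * ‖φ (ι y) - φ a‖ := by ring
    _ ≤ κ * ‖φ (ι y) - φ a‖ := mul_le_mul_of_nonneg_right hεκ (norm_nonneg _)

/-- **The image of an open set under the data embedding is relatively open in `ι(X)`**: all points
of `ι(X)` near `ι y`, `y ∈ O`, lie in `ι(O)` (`ι` is a topological embedding). [folklore] -/
theorem eventually_mem_image_of_isOpen (𝒮 : DataEmbedding D) {O : Set X} (hO : IsOpen O) {y : X}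
    (hy : y ∈ O) : ∀ᶠ σ in 𝓝 (𝒮.embed y), σ ∈ range 𝒮.embed → σ ∈ 𝒮.embed '' O := by
  have hemb : IsEmbedding 𝒮.embed := 𝒮.isSmoothEmbedding.isEmbedding
  obtain ⟨U, hUo, hUO⟩ := hemb.isInducing.isOpen_iff.1 hO
  have hyU : 𝒮.embed y ∈ U := by
    have : y ∈ 𝒮.embed ⁻¹' U := by rw [hUO]; exact hy
    exact this
  filter_upwards [hUo.mem_nhds hyU] with σ hσU hσS
  obtain ⟨z, rfl⟩ := hσS
  exact ⟨z, by rw [← hUO]; exact hσU, rfl⟩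

end DataEmbedding

namespace CauchyDevelopment

/-- **The domain of dependence of an open piece of the Cauchy hypersurface of a Cauchy
development.** Let `𝒟 = (M, g, τ, ι, ν)` be a Cauchy development of data on `X` and `O ⊆ X` open
and connected. Then there is a connected open sub-spacetime `V ⊆ M` containing `ι(O)`, disjoint
from `closure (I⁺(ι(X) ∖ ι(O)) ∪ I⁻(ι(X) ∖ ι(O)) ∪ (ι(X) ∖ ι(O)))`, in which `ι(O)` is a Cauchy
hypersurface — the connected component containing `ι(O)` of the complement of that closure
(for a ball `O` in the flat slice of Minkowski space: the open double cone over `ι(O)`).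
Assembled from `IsCauchyHypersurface.exists_isConnected_restrict` (pure causality,
`CauchyPieceDomain`), the endpoint property of timelike curves
(`mem_chronologicalFuture_of_hasPastEndpoint`, `CausalCurveEndpoint`), and the local theorem for
spacelike pieces (`IsCauchyHypersurface.disjoint_closure_of_spacelike`, `SpacelikePieceDomain`)
fed with `DataEmbedding.eventually_abs_val_normal_le`. This is the form of Hawking–Ellis 1973,
Prop. 6.6.3/6.6.7 and O'Neill 1983, Ch. 14, Thm. 14.38 / Lemma 14.43 ("`D(S)` is globally
hyperbolic with Cauchy hypersurface `S`") used for sub-data of a Cauchy development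
(Choquet-Bruhat–Geroch 1969, p. 333; Sbierski 2016, proof of Thm. 3.5).
[cite: ONeillSemiRiemannian1983, Ch. 14, Thm. 14.38 and Lemma 14.43 (pp. 423–426); HawkingEllis1973CUP, §6.6, Prop. 6.6.3] -/
theorem exists_isConnected_restrict_image (𝒟 : CauchyDevelopment D) {O : Set X} (hO : IsOpen O)
    (hOc : IsConnected O) :
    ∃ V : Opens 𝒟.carrier, IsConnected (V : Set 𝒟.carrier) ∧ 𝒟.embed '' O ⊆ V ∧
      Disjoint (V : Set 𝒟.carrier) (closure
        (𝒟.metric.chronologicalFuture 𝒟.timeOrientation (range 𝒟.embed \ 𝒟.embed '' O) ∪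
          𝒟.metric.chronologicalPast 𝒟.timeOrientation (range 𝒟.embed \ 𝒟.embed '' O) ∪
          (range 𝒟.embed \ 𝒟.embed '' O))) ∧
      (𝒟.metric.restrict PseudoRiemannianMetric.contMDiff_restrict_holds V).IsCauchyHypersurface
        (𝒟.timeOrientation.restrict PseudoRiemannianMetric.contMDiff_restrict_holds
          𝒟.timeOrientation.contMDiff_restrict_holds V) (Subtype.val ⁻¹' (𝒟.embed '' O)) := by
  set g := 𝒟.metric with hg
  set τ := 𝒟.timeOrientation with hτ_def
  haveI : Fact ((1 : ℕ∞ω) ≤ ∞) := ⟨by exact_mod_cast le_top⟩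
  haveI : g.HasLeviCivita := g.toPseudoRiemannianMetric.hasLeviCivita
  haveI : CovariantDerivative.ContMDiffCovariantDerivative g.leviCivita 1 :=
    ⟨g.toPseudoRiemannianMetric.isLocallyContMDiff_leviCivita_holds 1
      (by rw [show ((1 : ℕ∞) : ℕ∞ω) + 1 = 2 by norm_num]; exact WithTop.coe_le_coe.2 le_top)
      univ isOpen_univ⟩
  haveI : LocallyConnectedSpace 𝒟.carrier :=
    ChartedSpace.locallyConnectedSpace (EuclideanSpace ℝ (Fin (n + 1))) 𝒟.carrier
  have hn2 : (2 : ℕ∞ω) ≤ ∞ := WithTop.coe_le_coe.mpr le_top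
  have hninf : (∞ : ℕ∞ω) ≤ ∞ := le_rfl
  have hS : g.IsCauchyHypersurface τ (range 𝒟.embed) := 𝒟.isCauchyHypersurface
  have hAS : 𝒟.embed '' O ⊆ range 𝒟.embed := image_subset_range _ _
  have hA : ∀ a ∈ 𝒟.embed '' O, ∀ᶠ σ in 𝓝 a, σ ∈ range 𝒟.embed → σ ∈ 𝒟.embed '' O := by
    rintro _ ⟨y, hy, rfl⟩
    exact 𝒟.toDataEmbedding.eventually_mem_image_of_isOpen hO hy
  have hslab : ∀ a ∈ 𝒟.embed '' O, ∃ ν : TangentSpace (𝓡 (n + 1)) a,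
      g.IsTimelike ν ∧ τ.IsFutureDirected ν ∧ ∀ κ : ℝ, 0 < κ → ∀ᶠ σ in 𝓝 a, σ ∈ range 𝒟.embed →
        |g.val a ν (extChartAt (𝓡 (n + 1)) a σ - extChartAt (𝓡 (n + 1)) a a)| ≤
          κ * ‖extChartAt (𝓡 (n + 1)) a σ - extChartAt (𝓡 (n + 1)) a a‖ := by
    rintro _ ⟨y, hy, rfl⟩
    refine ⟨𝒟.normal y, ?_, 𝒟.isFutureUnitNormal.2 y, fun κ hκ ↦
      𝒟.toDataEmbedding.eventually_abs_val_normal_le y hκ⟩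
    show g.val _ (𝒟.normal y) (𝒟.normal y) < 0
    rw [𝒟.isFutureUnitNormal.1.2 y]
    norm_num
  have hdisj := LorentzianMetric.IsCauchyHypersurface.disjoint_closure_of_spacelike hn2 hS hAS hA
    hslab
  have hE : ∀ {c : ℝ → 𝒟.carrier} {s : Set ℝ} {e : 𝒟.carrier} {t t' : ℝ}, s.OrdConnected →
      g.IsFutureTimelikeCurveOn τ c s → HasPastEndpoint c s e → t ∈ s → t' ∈ s → t < t' →
      c t' ∈ g.chronologicalFuture τ {e} := fun hs hc he ht ht' htt' ↦
    LorentzianMetric.mem_chronologicalFuture_of_hasPastEndpoint τ hninf hs hc he ht ht' htt'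
  have hE' : ∀ {c : ℝ → 𝒟.carrier} {s : Set ℝ} {e : 𝒟.carrier} {t t' : ℝ}, s.OrdConnected →
      g.IsFutureTimelikeCurveOn τ.reverse c s → HasPastEndpoint c s e → t ∈ s → t' ∈ s → t < t' →
      c t' ∈ g.chronologicalFuture τ.reverse {e} := fun hs hc he ht ht' htt' ↦
    LorentzianMetric.mem_chronologicalFuture_of_hasPastEndpoint τ.reverse hninf hs hc he ht ht' htt'
  obtain ⟨y₀, hy₀⟩ := hOc.1
  have hAc : IsPreconnected (𝒟.embed '' O) :=
    (hOc.image 𝒟.embed 𝒟.isSmoothEmbedding.contMDiff.continuous.continuousOn).isPreconnected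
  obtain ⟨V, hVc, hAV, hVdisj, hV⟩ := hS.exists_isConnected_restrict hn2 hE hE'
    PseudoRiemannianMetric.contMDiff_restrict_holds τ.contMDiff_restrict_holds hAS hdisj hAc
    (a₀ := 𝒟.embed y₀) ⟨y₀, hy₀, rfl⟩
  exact ⟨V, hVc, hAV, hVdisj, hV⟩

/-- **The same for the range of an open embedding `Φ : N → X` of a connected manifold** — the
shape in which the domain-of-dependence input of the sub-data development theorem is consumed
(`hc` of `SubdataDevelopmentsEmbed.hdod_of_cauchyRegion`, route SwallowTheDatum of
`FinalStateConjecture`; Choquet-Bruhat–Geroch 1969, p. 333): there is a connected open `V ⊆ M`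
containing `ι(Φ N)` in which `ι(Φ N)` is a Cauchy hypersurface.
[cite: ONeillSemiRiemannian1983, Ch. 14, Thm. 14.38 and Lemma 14.43 (pp. 423–426); ChoquetBruhatGeroch1969CMP, p. 333] -/
theorem exists_isConnected_restrict_range_comp (𝒟 : CauchyDevelopment D) {N : Type*}
    [TopologicalSpace N] [ConnectedSpace N] {Φ : N → X} (hΦ : IsOpenEmbedding Φ) :
    ∃ V : Opens 𝒟.carrier, IsConnected (V : Set 𝒟.carrier) ∧ (∀ u, 𝒟.embed (Φ u) ∈ V) ∧
      (𝒟.metric.restrict PseudoRiemannianMetric.contMDiff_restrict_holds V).IsCauchyHypersurface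
        (𝒟.timeOrientation.restrict PseudoRiemannianMetric.contMDiff_restrict_holds
          𝒟.timeOrientation.contMDiff_restrict_holds V) (Subtype.val ⁻¹' range (𝒟.embed ∘ Φ)) := by
  have hO : IsOpen (range Φ) := hΦ.isOpen_range
  have hOc : IsConnected (range Φ) := isConnected_range hΦ.continuous
  obtain ⟨V, hVc, hAV, -, hV⟩ := 𝒟.exists_isConnected_restrict_image hO hOc
  refine ⟨V, hVc, fun u ↦ hAV ⟨Φ u, ⟨u, rfl⟩, rfl⟩, ?_⟩
  rw [range_comp]
  exact hV

/-- **The Cauchy hypersurface `ι(X)` of a Cauchy development is acausal**: no future causal curve on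
`[a, b]`, `a < b`, starts and ends on `ι(X)` (so every endless causal curve meets `ι(X)` exactly
once, with `IsCauchyHypersurface.exists_mem_of_isEndlessCausalCurve_holds`).
`IsCauchyHypersurface.false_of_isFutureCausalCurveOn_of_spacelike` with the slab condition
`DataEmbedding.eventually_abs_val_normal_le`. O'Neill 1983, Ch. 14, p. 425; Hawking–Ellis 1973,
§6.5. [cite: ONeillSemiRiemannian1983, Ch. 14, Lemma 14.42 ff. (p. 425)] -/
theorem false_of_isFutureCausalCurveOn_range_embed (𝒟 : CauchyDevelopment D)
    {γ : ℝ → 𝒟.carrier} {a b : ℝ} (hab : a < b)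
    (hγ : 𝒟.metric.IsFutureCausalCurveOn 𝒟.timeOrientation γ (Icc a b))
    (ha : γ a ∈ range 𝒟.embed) (hb : γ b ∈ range 𝒟.embed) : False := by
  have hn2 : (2 : ℕ∞ω) ≤ ∞ := WithTop.coe_le_coe.mpr le_top
  refine LorentzianMetric.IsCauchyHypersurface.false_of_isFutureCausalCurveOn_of_spacelike hn2
    𝒟.isCauchyHypersurface (fun a' ha' ↦ ?_) hab hγ ha hb
  obtain ⟨y, rfl⟩ := ha'
  refine ⟨𝒟.normal y, ?_, fun κ hκ ↦ 𝒟.toDataEmbedding.eventually_abs_val_normal_le y hκ⟩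
  show 𝒟.metric.val _ (𝒟.normal y) (𝒟.normal y) < 0
  rw [𝒟.isFutureUnitNormal.1.2 y]
  norm_num

end CauchyDevelopment

end Literature.Geometry.Lorentzian

end
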